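import Literature.NumberTheory.EllipticCurves.HeegnerPointsKolyvaginPrimaryEigenProofs
import Summits.BirchSwinnertonDyer.BirchSwinnertonDyer.Theses.CMKolyvaginAtInertTwo
import HarnessLib

/-!
# McCallum's Lemma 5.3 / Gross's Prop. 8.1 AT THE PRIME 2: eigen-lines of `E[2^M]` under a
# transposition-type complex conjugation, the index-2 defect, and the local-duality descent step
# with its one-bit loss (route CMKolyvaginAtInertTwo, crux 22836 `CMKolyvaginExactAtInertTwo`)

Seat `bsd-line-cmk2-p1` g2 (cell `bsd-print-cf2`). Summit-side THEOREM-ONLY file (pure algebra of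
finite abelian groups; no definition, no named fact, no `sorry`).

The tree's kernel Kolyvagin machine (`Literature/…/HeegnerPointsKolyvaginPrimary*Proofs.lean`,
consumed by `Summits/…/Rank1Residual/X11b/KolyvaginSha*`) uses `p ≠ 2` essentially in ONE leaf:
`KolyvaginEigenPow` (`HeegnerPointsKolyvaginPrimaryEigenProofs.lean`) — for `p` odd, `2` is
invertible mod `p^M`, so `T = E[p^M] = T⁺ ⊕ T⁻` under complex conjugation `ι`, both eigen-parts are
cyclic of order `p^M`, the Weil pairing `e(u, w)` of their generators has order EXACTLY `p^M`, and a
ramified Kolyvagin class of order `> p^a` kills `p^{M-1-a} s_λ` (`pow_nsmul_eq_zero_of_pairing_eq_zero`).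
This file proves what survives at `p = 2` when `ι` is of TRANSPOSITION type on `T[2]` (complex
conjugation on `E[2]` for `Δ_E < 0` — the whole habitat H₂ of the route, and every curve with
negative discriminant), for `T` finite abelian killed by `2^M`, `#T = 4^M`, `#T[2] = 4`, `M ≥ 1`:

* `two_nsmul_eq_fixed_add_anti` — `2z = (z + ιz) + (z − ιz)`: only `2T ⊂ T⁺ + T⁻` (no splitting);
* `exists_eigen_generators_two` — **both eigen-lines are cyclic of order `2^M`**, `T⁺ = ℤu`,
  `T⁻ = ℤw`, `(1+ι)T = T⁺` (every fixed vector is a `z + ιz`), `2z ∈ ℤu + ℤw` for all `z`, and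
  **`2^{M-1} u = 2^{M-1} w`** — the two lines MEET in their common 2-torsion, so `T⁺ + T⁻` has
  index `2` in `T` (the "index-2 defect"; at `M = 1`: `T⁺ = T⁻ = {0, T_ℝ}`);
* `addOrderOf_pairing_eq_two` — for an alternating left-non-degenerate biadditive `e` on `T`,
  **`e(u, w)` has order exactly `2^{M-1}`** (NOT `2^M`): one bit is lost;
* `pow_nsmul_eq_zero_of_pairing_eq_zero_two` — the descent step at `2`: `x ∈ ℤu`, `y₀ ∈ ℤw`,
  `e(u,w)` of order `2^{M-1}`, `2^a y₀ ≠ 0`, `e(x, y₀) = 0` ⟹ **`2^{M-a} x = 0`** (vs. `p^{M-1-a} x = 0`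
  at odd `p`); in particular at `a = M - 1` (a ramified class of full order) the conclusion
  `2x = 0` does NOT kill a `2`-torsion Frobenius value — the algebraic form of the observation
  (MEMO `Cruxes/CMExactDescentAtTwo/MEMO-tau-line-at-two.md`) that the single-prime Kolyvagin
  reciprocity constraint is void on `τ`-invariant `2`-Selmer classes when `Δ_E < 0`.

HONEST FRAMING. Pure algebra; the `p = 2` replacement of leaf (B) of the tree's machine, for any
future port of the Kolyvagin bound/structure argument to `2` (this route's 22836, route
GenusKolyvaginAtTwo's 22137). Nothing about `Ш` is proved here; no item is closed; beyond-print
theorem: the statements at `2` are not in print (McCallum/Gross take `p` odd), the mathematics is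
elementary. BSD is not proved by any of this.

References: [McCallumLMS1991] §5 Lemma 5.3 (p odd); [GrossLMS1991] §8 Prop. 8.1 (p odd);
[Kolyvagin1989Izv] Thm. B_l at l = 2 (the printed l = 2 argument, auxiliary level `l^{n+m}`).
-/

set_option autoImplicit false
set_option linter.dupNamespace false

open scoped Classical

namespace Summit.BirchSwinnertonDyer.BirchSwinnertonDyer.Theorems.KolyvaginEigenTwo

open Literature.NumberTheory.EllipticCurves
open Literature.NumberTheory.EllipticCurves.KolyvaginEigenPow

variable {T : Type*} [AddCommGroup T] {M : ℕ}

/-! ### §1 What replaces the eigen-decomposition at `2` -/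

/-- `2z = (z + ιz) + (z − ιz)` with the first summand `ι`-fixed and the second `ι`-anti-fixed: at
`p = 2` only `2T ⊂ T⁺ + T⁻` survives of Gross's (5.1). [cite: GrossLMS1991, §5 (5.1)] -/
theorem two_nsmul_eq_fixed_add_anti (ι : T →+ T) (hι : ∀ x, ι (ι x) = x) (z : T) :
    2 • z = (z + ι z) + (z - ι z) ∧ ι (z + ι z) = z + ι z ∧ ι (z - ι z) = -(z - ι z) := by
  refine ⟨by abel, by rw [map_add, hι, add_comm], by rw [map_sub, hι, neg_sub]⟩

/-- A cyclic group killed by `2^M` has order dividing `2^M`. [folklore] -/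
private theorem card_le_of_cyclic {H : AddSubgroup T} (hcyc : IsAddCyclic H)
    (hH : ∀ g : H, 2 ^ M • g = 0) : Nat.card H ∣ 2 ^ M := by
  obtain ⟨g, hg⟩ := hcyc.exists_ofOrder_eq_natCard
  rw [← hg]
  exact addOrderOf_dvd_of_nsmul_eq_zero (hH g)

/-! ### §2 Generators of the two eigen-lines at `2` (transposition type) -/

/-- **Eigen-lines at `2`.** Let `T` be finite abelian, killed by `2^M` (`M ≥ 1`), of order `4^M`
with `#T[2] = 4` (`T = E[2^M]`), and `ι` an additive involution of TRANSPOSITION type: some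
`2`-torsion vector is moved by `ι` (complex conjugation on `E[2]` when `Δ_E < 0`). Then
`T⁺ = ℤu` and `T⁻ = ℤw` are cyclic of order `2^M`, every `ι`-fixed vector is of the form
`z + ιz`, `2z ∈ ℤu + ℤw` for every `z`, and `2^{M-1}u = 2^{M-1}w` (the lines meet in their
`2`-torsion; `T⁺ + T⁻` has index `2`). Proof: `T⁺[2]`, `T⁻[2]` are proper in `T[2]` (both miss
the moved vector), so `T^±` are cyclic (`isAddCyclic_of_card_torsion_le`) of order `≤ 2^M`;
`(1+ι)` has kernel `T⁻` and image in `T⁺`, so `4^M = #T ≤ #T⁻·#T⁺ ≤ 4^M`.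
[cite: McCallumLMS1991, §5 Lemma 5.3 (p odd analogue)] [cite: GrossLMS1991, Prop. 8.1 (1) (p odd analogue)] -/
theorem exists_eigen_generators_two [Finite T] (hM : 1 ≤ M) (hT : ∀ t : T, 2 ^ M • t = 0)
    (hcard : Nat.card T = 2 ^ (2 * M)) (hcard2 : Nat.card {x : T // 2 • x = 0} = 2 ^ 2)
    (ι : T →+ T) (hι : ∀ x, ι (ι x) = x) {v₂ : T} (hv₂2 : 2 • v₂ = 0) (hv₂ : ι v₂ ≠ v₂) :
    ∃ u w : T, ι u = u ∧ ι w = -w ∧ (∀ x, ι x = x → x ∈ AddSubgroup.zmultiples u) ∧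
      (∀ x, ι x = -x → x ∈ AddSubgroup.zmultiples w) ∧
      addOrderOf u = 2 ^ M ∧ addOrderOf w = 2 ^ M ∧
      (∀ x, ι x = x → ∃ z, x = z + ι z) ∧
      (∀ z, ∃ β δ : ℤ, 2 • z = β • u + δ • w) ∧
      2 ^ (M - 1) • u = 2 ^ (M - 1) • w := by
  classical
  have hp : Nat.Prime 2 := Nat.prime_two
  haveI : Fact (Nat.Prime 2) := ⟨hp⟩
  set P : AddSubgroup T := (ι - AddMonoidHom.id T).ker with hPdef
  set f : T →+ T := ι + AddMonoidHom.id T with hfdef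
  set Q : AddSubgroup T := f.ker with hQdef
  set S : AddSubgroup T := (DistribSMul.toAddMonoidHom T (2 : ℕ)).ker with hSdef
  have hmemP : ∀ x, x ∈ P ↔ ι x = x := fun x ↦ by
    rw [hPdef, AddMonoidHom.mem_ker, AddMonoidHom.sub_apply, AddMonoidHom.id_apply, sub_eq_zero]
  have hmemQ : ∀ x, x ∈ Q ↔ ι x = -x := fun x ↦ by
    rw [hQdef, AddMonoidHom.mem_ker, hfdef, AddMonoidHom.add_apply, AddMonoidHom.id_apply,
      add_eq_zero_iff_eq_neg]
  have hmemS : ∀ x, x ∈ S ↔ 2 • x = 0 := fun x ↦ by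
    rw [hSdef, AddMonoidHom.mem_ker, DistribSMul.toAddMonoidHom_apply]
  have hScard : Nat.card S = 2 ^ 2 := by
    rw [← hcard2]; exact Nat.card_congr (Equiv.subtypeEquivRight fun x ↦ hmemS x)
  have hSfin : Nat.card S ≠ 0 := by rw [hScard]; norm_num
  haveI : Finite S := Nat.finite_of_card_ne_zero hSfin
  -- `v₂ ∈ S` is neither fixed nor anti-fixed (at `2`, anti-fixed 2-torsion = fixed)
  have hv₂S : v₂ ∈ S := (hmemS _).mpr hv₂2
  have hneg2 : ∀ {x : T}, 2 • x = 0 → -x = x := fun {x} hx ↦ by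
    rw [neg_eq_iff_add_eq_zero, ← two_nsmul, hx]
  have hv₂P : v₂ ∉ P := fun h ↦ hv₂ ((hmemP _).mp h)
  have hv₂Q : v₂ ∉ Q := fun h ↦ hv₂ (by rw [(hmemQ _).mp h, hneg2 hv₂2])
  -- the 2-torsion of `P` and of `Q` has at most 2 elements
  have hle2 : ∀ (R : AddSubgroup T), v₂ ∉ R → Nat.card (S ⊓ R : AddSubgroup T) ≤ 2 := by
    intro R hR
    have hdvd : Nat.card (S ⊓ R : AddSubgroup T) ∣ 2 ^ 2 :=
      hScard ▸ AddSubgroup.card_dvd_of_le inf_le_left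
    obtain ⟨i, hi2, hi⟩ := (Nat.dvd_prime_pow hp).mp hdvd
    have hne : Nat.card (S ⊓ R : AddSubgroup T) ≠ 2 ^ 2 := by
      intro h4
      have heq : (S ⊓ R : AddSubgroup T) = S :=
        AddSubgroup.eq_of_le_of_card_ge inf_le_left (by rw [h4, hScard])
      exact hR (AddSubgroup.mem_inf.mp (heq.symm ▸ hv₂S : v₂ ∈ S ⊓ R)).2
    rw [hi] at hne ⊢
    interval_cases i <;> simp_all
  have hcyc : ∀ (R : AddSubgroup T), v₂ ∉ R → IsAddCyclic R := by
    intro R hR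
    refine isAddCyclic_of_card_torsion_le (M := M) hp (fun g ↦ Subtype.ext ?_)
      (le_trans (le_of_eq ?_) (hle2 R hR))
    · rw [AddSubgroupClass.coe_nsmul, ZeroMemClass.coe_zero]; exact hT _
    · refine Nat.card_congr ?_
      exact
        { toFun := fun g ↦ ⟨g.1.1, AddSubgroup.mem_inf.mpr ⟨(hmemS _).mpr (by
            have := congrArg Subtype.val g.2
            rwa [AddSubgroupClass.coe_nsmul, ZeroMemClass.coe_zero] at this), g.1.2⟩⟩
          invFun := fun x ↦ ⟨⟨x.1, (AddSubgroup.mem_inf.mp x.2).2⟩, Subtype.ext (by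
            rw [AddSubgroupClass.coe_nsmul, ZeroMemClass.coe_zero]
            exact (hmemS _).mp (AddSubgroup.mem_inf.mp x.2).1)⟩
          left_inv := fun g ↦ rfl
          right_inv := fun x ↦ rfl }
  have hTR : ∀ (R : AddSubgroup T) (g : R), 2 ^ M • g = 0 := fun R g ↦ Subtype.ext (by
    rw [AddSubgroupClass.coe_nsmul, ZeroMemClass.coe_zero]; exact hT _)
  have hPdvd : Nat.card P ∣ 2 ^ M := card_le_of_cyclic (hcyc P hv₂P) (hTR P)
  have hQdvd : Nat.card Q ∣ 2 ^ M := card_le_of_cyclic (hcyc Q hv₂Q) (hTR Q)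
  -- `#T = #Q · #range f` and `range f ≤ P`
  have hrange : f.range ≤ P := by
    rintro _ ⟨z, rfl⟩
    rw [hmemP, hfdef, AddMonoidHom.add_apply, AddMonoidHom.id_apply, map_add, hι, add_comm]
  have hTcard : Nat.card T = Nat.card Q * Nat.card f.range := by
    rw [hQdef, AddSubgroup.card_eq_card_quotient_mul_card_addSubgroup f.ker, mul_comm,
      Nat.card_congr (QuotientAddGroup.quotientKerEquivRange f).toEquiv]
  haveI : Finite P := inferInstance
  have hrangeP : Nat.card f.range ≤ Nat.card P := AddSubgroup.card_le_of_le hrange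
  have hpow : (2 : ℕ) ^ (2 * M) = 2 ^ M * 2 ^ M := by rw [two_mul, pow_add]
  have hPpos : 0 < 2 ^ M := pow_pos two_pos M
  have hPle : Nat.card P ≤ 2 ^ M := Nat.le_of_dvd hPpos hPdvd
  have hQle : Nat.card Q ≤ 2 ^ M := Nat.le_of_dvd hPpos hQdvd
  have hPeq : Nat.card P = 2 ^ M := by
    by_contra hne
    have hlt : Nat.card P < 2 ^ M := lt_of_le_of_ne hPle hne
    have : Nat.card T < 2 ^ M * 2 ^ M :=
      calc Nat.card T = Nat.card Q * Nat.card f.range := hTcard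
        _ ≤ 2 ^ M * Nat.card P := Nat.mul_le_mul hQle hrangeP
        _ < 2 ^ M * 2 ^ M := Nat.mul_lt_mul_of_pos_left hlt hPpos
    rw [hcard, hpow] at this
    exact lt_irrefl _ this
  have hQeq : Nat.card Q = 2 ^ M := by
    by_contra hne
    have hlt : Nat.card Q < 2 ^ M := lt_of_le_of_ne hQle hne
    have : Nat.card T < 2 ^ M * 2 ^ M :=
      calc Nat.card T = Nat.card Q * Nat.card f.range := hTcard
        _ ≤ Nat.card Q * Nat.card P := Nat.mul_le_mul_left _ hrangeP
        _ < 2 ^ M * 2 ^ M := Nat.mul_lt_mul_of_lt_of_le hlt hPle hPpos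
    rw [hcard, hpow] at this
    exact lt_irrefl _ this
  have hrange_eq : f.range = P := by
    refine AddSubgroup.eq_of_le_of_card_ge hrange ?_
    have h1 : Nat.card Q * Nat.card f.range = Nat.card Q * Nat.card P := by
      rw [← hTcard, hcard, hpow, hQeq, hPeq]
    exact le_of_eq (Nat.eq_of_mul_eq_mul_left (by rw [hQeq]; exact hPpos) h1).symm
  -- generators
  obtain ⟨gP, hgP⟩ := (hcyc P hv₂P).exists_zsmul_surjective
  obtain ⟨gQ, hgQ⟩ := (hcyc Q hv₂Q).exists_zsmul_surjective
  set u : T := gP.1 with hu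
  set w : T := gQ.1 with hw
  have hPu : ∀ x, ι x = x → x ∈ AddSubgroup.zmultiples u := fun x hx ↦ by
    obtain ⟨k, hk⟩ := hgP ⟨x, (hmemP x).mpr hx⟩
    exact AddSubgroup.mem_zmultiples_iff.mpr ⟨k, by
      have := congrArg Subtype.val hk
      rwa [AddSubgroupClass.coe_zsmul] at this⟩
  have hQw : ∀ x, ι x = -x → x ∈ AddSubgroup.zmultiples w := fun x hx ↦ by
    obtain ⟨k, hk⟩ := hgQ ⟨x, (hmemQ x).mpr hx⟩
    exact AddSubgroup.mem_zmultiples_iff.mpr ⟨k, by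
      have := congrArg Subtype.val hk
      rwa [AddSubgroupClass.coe_zsmul] at this⟩
  have hPeq' : P = AddSubgroup.zmultiples u :=
    le_antisymm (fun x hx ↦ hPu x ((hmemP x).mp hx)) (AddSubgroup.zmultiples_le.mpr gP.2)
  have hQeq' : Q = AddSubgroup.zmultiples w :=
    le_antisymm (fun x hx ↦ hQw x ((hmemQ x).mp hx)) (AddSubgroup.zmultiples_le.mpr gQ.2)
  have hou : addOrderOf u = 2 ^ M := by rw [← Nat.card_zmultiples, ← hPeq', hPeq]
  have how : addOrderOf w = 2 ^ M := by rw [← Nat.card_zmultiples, ← hQeq', hQeq]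
  have hιu : ι u = u := (hmemP u).mp gP.2
  have hιw : ι w = -w := (hmemQ w).mp gQ.2
  -- `2^{M-1} u = 2^{M-1} w`: both are the unique element of order 2 of `Q = ℤw`
  obtain ⟨n, hn⟩ : ∃ n, M = n + 1 := ⟨M - 1, by omega⟩
  have hMn : M - 1 = n := by omega
  have htu2 : 2 • (2 ^ n • u) = 0 := by rw [smul_smul, ← pow_succ', ← hn]; exact hT u
  have htuQ : 2 ^ n • u ∈ Q := by
    rw [hmemQ, map_nsmul, hιu, hneg2 htu2]
  have htu0 : 2 ^ n • u ≠ 0 := by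
    have := pow_pred_nsmul_ne_zero hp hM hou
    rwa [hMn] at this
  have hMw : ((2 : ℤ) ^ (n + 1)) • w = 0 := by
    rw [show ((2 : ℤ) ^ (n + 1)) = ((2 ^ M : ℕ) : ℤ) by rw [hn]; push_cast; rfl, natCast_zsmul,
      hT w]
  have hmeet : 2 ^ n • u = 2 ^ n • w := by
    rw [hQeq'] at htuQ
    obtain ⟨k, hk⟩ := AddSubgroup.mem_zmultiples_iff.mp htuQ
    have htu2z : (2 : ℤ) • (2 ^ n • u) = 0 := by rw [two_zsmul, ← two_nsmul, htu2]
    have h2k : (2 * k) • w = 0 := by rw [mul_smul, hk, htu2z]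
    have hdvd : ((2 ^ M : ℕ) : ℤ) ∣ 2 * k := by
      rw [← how]; exact (addOrderOf_dvd_iff_zsmul_eq_zero).mpr h2k
    rw [hn] at hdvd
    push_cast at hdvd
    rw [pow_succ'] at hdvd
    obtain ⟨k', rfl⟩ : (2 : ℤ) ^ n ∣ k := (mul_dvd_mul_iff_left two_ne_zero).mp hdvd
    -- `k'` is odd, else `2^n • u = 0`
    have hk'odd : Odd k' := by
      by_contra heven
      rw [Int.not_odd_iff_even] at heven
      obtain ⟨j, hj⟩ := heven
      apply htu0
      rw [← hk, hj, ← two_mul, ← mul_assoc, ← pow_succ, mul_comm, mul_smul, hMw, smul_zero]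
    obtain ⟨j, hj⟩ := hk'odd
    rw [← hk, hj, mul_add, mul_one, add_smul, ← mul_assoc, ← pow_succ, mul_comm ((2 : ℤ) ^ (n + 1)) j,
      mul_smul, hMw, smul_zero, zero_add, show ((2 : ℤ) ^ n) = ((2 ^ n : ℕ) : ℤ) by push_cast; rfl, natCast_zsmul]
  refine ⟨u, w, hιu, hιw, hPu, hQw, hou, how, fun x hx ↦ ?_, fun z ↦ ?_, by rw [hMn]; exact hmeet⟩
  · -- every fixed vector is a `z + ιz` (the image of `f = ι + id` is all of `P`)
    have hxr : x ∈ f.range := by rw [hrange_eq, hmemP]; exact hx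
    obtain ⟨z, hz⟩ := hxr
    exact ⟨z, by rw [← hz, hfdef, AddMonoidHom.add_apply, AddMonoidHom.id_apply, add_comm]⟩
  · obtain ⟨h2, hfix, hanti⟩ := two_nsmul_eq_fixed_add_anti ι hι z
    obtain ⟨β, hβ⟩ := AddSubgroup.mem_zmultiples_iff.mp (hPu _ hfix)
    obtain ⟨δ, hδ⟩ := AddSubgroup.mem_zmultiples_iff.mp (hQw _ hanti)
    exact ⟨β, δ, by rw [h2, ← hβ, ← hδ]⟩

/-! ### §3 Perfectness up to ONE BIT: `e(u, w)` has order `2^{M-1}` -/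

/-- **At `2` the pairing of the two eigen-generators has order exactly `2^{M-1}`** (not `2^M`):
for `T` killed by `2^M`, `e` biadditive, alternating and left-non-degenerate, `u` of order `2^M`
with `ιu = u`-line data as produced by `exists_eigen_generators_two` — precisely: `2z ∈ ℤu + ℤw`
for all `z` and `2^{M-1}u ∈ ℤw`. Upper bound: `2^{M-1}u = k w` pairs trivially with `w`. Lower
bound: if `2^{M-2} e(u,w) = 0` then `t = 2^{M-2}u` pairs trivially with `ℤu + ℤw ⊇ 2T`, so `2t`
is in the left kernel, `2^{M-1}u = 0`, contradiction. The index-2 defect of `T⁺ + T⁻ ⊂ T` costs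
exactly one bit of the perfect duality of McCallum's Lemma 5.3.
[cite: McCallumLMS1991, §5 Lemma 5.3 (p odd analogue)] -/
theorem addOrderOf_pairing_eq_two (hM : 1 ≤ M) (hT : ∀ t : T, 2 ^ M • t = 0)
    {A : Type*} [AddCommGroup A] (e : T →+ T →+ A) (halt : ∀ x, e x x = 0)
    (hnd : ∀ x, (∀ y, e x y = 0) → x = 0) {u w : T} (hu : addOrderOf u = 2 ^ M)
    (h2 : ∀ z, ∃ β δ : ℤ, 2 • z = β • u + δ • w)
    (hmeet : 2 ^ (M - 1) • u ∈ AddSubgroup.zmultiples w) :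
    addOrderOf (e u w) = 2 ^ (M - 1) := by
  have hp : Nat.Prime 2 := Nat.prime_two
  haveI : Fact (Nat.Prime 2) := ⟨hp⟩
  -- upper bound: `2^{M-1} • e u w = 0`
  have hupper : 2 ^ (M - 1) • e u w = 0 := by
    obtain ⟨k, hk⟩ := AddSubgroup.mem_zmultiples_iff.mp hmeet
    rw [← natCast_zsmul, ← pairing_zsmul_left, natCast_zsmul, ← hk, pairing_zsmul_left, halt,
      smul_zero]
  rcases Nat.lt_or_ge M 2 with hM1 | hM2
  · -- `M = 1`: `e u w = 0`
    have hM1' : M = 1 := by omega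
    subst hM1'
    rw [Nat.sub_self, pow_zero, AddMonoid.addOrderOf_eq_one_iff]
    simpa using hupper
  · obtain ⟨n, hn⟩ : ∃ n, M - 1 = n + 1 := ⟨M - 2, by omega⟩
    rw [hn]
    refine addOrderOf_eq_prime_pow (fun h0 ↦ ?_) (by rw [← hn]; exact hupper)
    -- lower bound
    have hn' : n = M - 2 := by omega
    set t : T := 2 ^ n • u with ht
    have htu : e t u = 0 := by
      rw [ht, ← natCast_zsmul, pairing_zsmul_left, halt, smul_zero]
    have htw : e t w = 0 := by
      rw [ht, ← natCast_zsmul, pairing_zsmul_left, natCast_zsmul, h0]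
    have h2t : ∀ y, e (2 • t) y = 0 := fun y ↦ by
      obtain ⟨β, δ, hy⟩ := h2 y
      rw [← natCast_zsmul, pairing_zsmul_left, natCast_zsmul, ← map_nsmul, hy, map_add,
        map_zsmul, map_zsmul, htu, htw, smul_zero, smul_zero, add_zero]
    have h2t0 : 2 • t = 0 := hnd _ h2t
    have : 2 ^ (M - 1) • u = 0 := by
      rw [show M - 1 = n + 1 by omega, pow_succ, mul_comm, ← smul_smul, ← ht, h2t0]
    exact pow_pred_nsmul_ne_zero hp hM hu this

/-! ### §4 The descent step at `2`: one bit weaker than McCallum's Lemma 5.3 -/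

/-- **McCallum's Lemma 5.3 with a pairing of DEFICIENT order `p^{M-1}`, as a descent would use it**
(any prime `p`; the case that occurs at `p = 2`). `T` killed by `p^M`, `e` biadditive, `x ∈ ℤu` (a
Frobenius value of a Selmer class), `y₀ ∈ ℤw` (a tame value of a ramified Kolyvagin class), `e(u,w)`
of order `p^{M-1}`. If `p^a y₀ ≠ 0` and `e(x,y₀) = 0` then `p^{M-a} x = 0` (vs. `p^{M-1-a} x = 0`
when `e(u,w)` has the full order `p^M`, `KolyvaginEigenPow.pow_nsmul_eq_zero_of_pairing_eq_zero`):
`x = αu`, `y₀ = γw`, `p^{M-1} ∣ αγ`, `p^M ∤ p^a γ`, so `p^a ∣ α`.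
[cite: McCallumLMS1991, §5 Lemma 5.3 (with Prop. 2.2), p odd analogue] -/
theorem pow_nsmul_eq_zero_of_pairing_eq_zero_pred {p : ℕ} (hp : p.Prime)
    (hT : ∀ t : T, p ^ M • t = 0)
    {A : Type*} [AddCommGroup A] (e : T →+ T →+ A) {u w x y₀ : T}
    (hx : x ∈ AddSubgroup.zmultiples u) (hy₀ : y₀ ∈ AddSubgroup.zmultiples w)
    (hω : addOrderOf (e u w) = p ^ (M - 1)) {a : ℕ} (ha : p ^ a • y₀ ≠ 0) (he : e x y₀ = 0) :
    p ^ (M - a) • x = 0 := by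
  haveI : Fact p.Prime := ⟨hp⟩
  obtain ⟨α, rfl⟩ := AddSubgroup.mem_zmultiples_iff.mp hx
  obtain ⟨γ, rfl⟩ := AddSubgroup.mem_zmultiples_iff.mp hy₀
  -- `p^{M-1} ∣ α γ`
  have h1 : (α * γ) • e u w = 0 := by
    rw [mul_comm, mul_smul, ← pairing_zsmul_left, ← map_zsmul]
    exact he
  have hdvd : ((p ^ (M - 1) : ℕ) : ℤ) ∣ α * γ := by
    rw [← hω]
    exact (addOrderOf_dvd_iff_zsmul_eq_zero).mpr h1
  -- `p^M ∤ p^a γ`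
  have hγ0 : γ ≠ 0 := by
    rintro rfl
    exact ha (by rw [zero_smul, smul_zero])
  have hndvd : ¬ ((p ^ M : ℕ) : ℤ) ∣ (p : ℤ) ^ a * γ := by
    rintro ⟨k, hk⟩
    apply ha
    rw [← natCast_zsmul, smul_smul, Nat.cast_pow, hk, mul_comm, mul_smul, natCast_zsmul, hT,
      smul_zero]
  -- valuations: `v(α) + v(γ) ≥ M - 1`, `a + v(γ) < M`, so `p^a ∣ α`
  by_cases hα0 : α = 0
  · rw [hα0, zero_smul, smul_zero]
  rw [Nat.cast_pow, padicValInt_dvd_iff] at hdvd hndvd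
  rcases hdvd with h0 | hM
  · exact absurd h0 (mul_ne_zero hα0 hγ0)
  rw [padicValInt.mul hα0 hγ0] at hM
  have hpa0 : (p : ℤ) ^ a ≠ 0 := pow_ne_zero _ (by exact_mod_cast hp.ne_zero)
  push Not at hndvd
  obtain ⟨-, hlt⟩ := hndvd
  have hva : padicValInt p ((p : ℤ) ^ a) = a := by
    rw [← Nat.cast_pow, padicValInt.of_nat, padicValNat.prime_pow]
  rw [padicValInt.mul hpa0 hγ0, hva] at hlt
  obtain ⟨α', rfl⟩ : (p : ℤ) ^ a ∣ α :=
    (padicValInt_dvd_iff a α).mpr (Or.inr (by omega))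
  have haM : a ≤ M := by omega
  rw [← natCast_zsmul, smul_smul]
  have hprod : ((p ^ (M - a) : ℕ) : ℤ) * ((p : ℤ) ^ a * α') = α' * ((p ^ M : ℕ) : ℤ) := by
    rw [Nat.cast_pow, Nat.cast_pow, ← mul_assoc, ← pow_add, Nat.sub_add_cancel haM, mul_comm]
  rw [hprod, mul_smul, natCast_zsmul, hT u, smul_zero]

/-- The `p = 2` instance of the preceding lemma: `2^{M-a} x = 0` — ONE BIT WEAKER than McCallum's
`p^{M-1-a} x = 0` at odd `p`; at `a = M - 1` (a ramified class of maximal order) the conclusion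
`2x = 0` is VOID on `2`-torsion Frobenius values: the single-prime argument cannot see `Sel₂^τ`.
[cite: McCallumLMS1991, §5 Lemma 5.3 (with Prop. 2.2), p odd analogue] -/
theorem pow_nsmul_eq_zero_of_pairing_eq_zero_two (hT : ∀ t : T, 2 ^ M • t = 0)
    {A : Type*} [AddCommGroup A] (e : T →+ T →+ A) {u w x y₀ : T}
    (hx : x ∈ AddSubgroup.zmultiples u) (hy₀ : y₀ ∈ AddSubgroup.zmultiples w)
    (hω : addOrderOf (e u w) = 2 ^ (M - 1)) {a : ℕ} (ha : 2 ^ a • y₀ ≠ 0) (he : e x y₀ = 0) :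
    2 ^ (M - a) • x = 0 :=
  pow_nsmul_eq_zero_of_pairing_eq_zero_pred Nat.prime_two hT e hx hy₀ hω ha he

/-- **The two §§ combined, in the shape the tree's machine consumes leaf (B)** (compare
`KolyvaginEigenPow.exists_eigen_generators` + `addOrderOf_pairing_eq` +
`pow_nsmul_eq_zero_of_pairing_eq_zero`): under the hypotheses of `exists_eigen_generators_two` and
for an alternating left-non-degenerate biadditive `e`, there are eigen-generators `u`, `w` with
`e(u,w)` of order `2^{M-1}`, and every `τ`-fixed `x` and anti-fixed `y₀` with `2^a y₀ ≠ 0`,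
`e(x, y₀) = 0` satisfy `2^{M-a} x = 0`. [cite: McCallumLMS1991, §5 Lemma 5.3 (p odd analogue)] -/
theorem descent_step_two [Finite T] (hM : 1 ≤ M) (hT : ∀ t : T, 2 ^ M • t = 0)
    (hcard : Nat.card T = 2 ^ (2 * M)) (hcard2 : Nat.card {x : T // 2 • x = 0} = 2 ^ 2)
    (ι : T →+ T) (hι : ∀ x, ι (ι x) = x) {v₂ : T} (hv₂2 : 2 • v₂ = 0) (hv₂ : ι v₂ ≠ v₂)
    {A : Type*} [AddCommGroup A] (e : T →+ T →+ A) (halt : ∀ x, e x x = 0)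
    (hnd : ∀ x, (∀ y, e x y = 0) → x = 0) :
    ∃ u w : T, ι u = u ∧ ι w = -w ∧ addOrderOf u = 2 ^ M ∧ addOrderOf w = 2 ^ M ∧
      addOrderOf (e u w) = 2 ^ (M - 1) ∧
      ∀ (x y₀ : T), ι x = x → ι y₀ = -y₀ → ∀ a : ℕ, 2 ^ a • y₀ ≠ 0 → e x y₀ = 0 →
        2 ^ (M - a) • x = 0 := by
  obtain ⟨u, w, hιu, hιw, hPu, hQw, hou, how, -, h2, hmeet⟩ :=
    exists_eigen_generators_two hM hT hcard hcard2 ι hι hv₂2 hv₂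
  have hmeet' : 2 ^ (M - 1) • u ∈ AddSubgroup.zmultiples w := by
    rw [hmeet, ← natCast_zsmul]
    exact AddSubgroup.zsmul_mem_zmultiples w _
  have hω := addOrderOf_pairing_eq_two hM hT e halt hnd hou h2 hmeet'
  exact ⟨u, w, hιu, hιw, hou, how, hω, fun x y₀ hx hy₀ a ha he ↦
    pow_nsmul_eq_zero_of_pairing_eq_zero_two hT e (hPu x hx) (hQw y₀ hy₀) hω ha he⟩

end Summit.BirchSwinnertonDyer.BirchSwinnertonDyer.Theorems.KolyvaginEigenTwo
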